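/-
COR-CM (cell pub-hodgecm2, stage 2 of the Hodge ladder) — Δ2 BRIDGE, (c)+(d) closure at ι₁ («WORLD = C» FINAL, 2026-08-23; ASSEMBLER MODULE
TABLE v1.2 «ι₁ ∕ Id CHAIN», row I8): the R3 residual {`M`, `jH`, `hjHinj`, `hjH`, `pieces`} of the END at the LIVE pin BY VALUE over the
UNTWISTED §4.2 datum (`X_K := M_K`, instlevel-a's `Model.honestP5IdOf ∕ sec42DataIdOf`), from ONE component-Albanese record at
instance `ι₁` (pin-a's I5 over prove-5's I5a cofan along `ι₁`).  Twin of prove-8's ✔ `R3OfComponentAlbaneseIota1.lean` (p373467) with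
the datum untwisted; THEOREMS ONLY (kernel lane); explicit per-declaration binders, no `variable`, no notation; nothing landed is edited or restated.
Seat prover-pub-hodgecm2-d2bridge-prove-5-g1-0 (I8 pen after prove-8's sign-off).  FRAMING: HC_CM is NOT proved; «Δ2 BRIDGE CLOSED» is NOT
claimed; `exists_recordSystem`, `heckeTranslate_definedOver`, `shimura1998_thm21_4_casselman` are cited named facts taken as hypotheses.
-/
import Summits.HodgeConjecture.CorCM.D2Bridge.Iota1.HcmPiecesAtPin
import Summits.HodgeConjecture.CorCM.D2Bridge.Iota1.ComponentAlbanesePin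
import Summits.HodgeConjecture.CorCM.D2Bridge.Iota1.UniformOmegaRep
import Summits.HodgeConjecture.CorCM.D2Bridge.JRecordSocketByValue
import HarnessLib

/-!
# Δ2 bridge, ι₁ ∕ Id chain, row I8 — the R3 residual at the LIVE pin from a component-Albanese record at instance `ι₁` (untwisted datum)

[Liu2021] Y. Liu, *Fourier–Jacobi cycles and arithmetic relative trace formula*, Camb. J. Math. **9** (2021) = arXiv:2102.11518.

Under WORLD = C the live `ι₁`-keyed dictionary `HodgeCM.Model.liuDictionaryPin` is the Liu-verbatim keying; over the twisted App-C datum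
`sec42DataOf` (`X_K := M_K^{(c)}`) the fifth field `pieces` has no honest producer (✔ `HcmS1WallCertificateConj`, ✔ K5), because the only cofan
is along `ῑ₁`.  Over the UNTWISTED datum `ℭ₁ := Model.sec42DataIdOf h iso …` the cofan runs along `ι₁` (prove-5 I5a
✔-filed `Iota1.exists_isColimit_componentInjId`), `J₁ : ComponentAlbaneseId … ℭ₁ 𝒯₁` lives at instance `ι₁` (pin-a I5), and then — THIS FILE —
all five R3 fields exist BY VALUE at the literal pin, at the rest `U.rest (restTailOne (AlgHom.id ℚ L) ι₁ …)` (instance = tail = key = `ι₁`):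

* `exists_r3Id_of_componentAlbaneseId` — GIVEN `J₁` with its level law: `M := Iota1.map43RecordAtPin J₁ (AlgHom.id ℚ L) ι₁ …` (prove-3's I6 twin
  of prove-2's record), `jH := Iota1.jHPin …` with `jHPin_injective ∕ jHPin_comm`, and `pieces` from prove-3's I7
  `Iota1.nonempty_hcmPieces_atLiuDictionaryPin (ιg := ι₁)` with the X3-Char input discharged from the END's key
  `hΦμ : HasCMType L μ (line i).lineType` read through the uniqueness of the CM type (✔ `IsConjugateSymplectic.cmType_eq`, [Liu2021] Rem. 4.2);
  prove-8's p373467 verbatim over `ComponentAlbaneseId`.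

The BY-VALUE head at the END′ (I11) binder shape, with `J₁ := componentAlbanesePinTotalId …` (I5), `Dμ := socketDμ …`, `U := uniformOmegaRepId …`
(I3), is the sequel section once rows I3∕I5 are in the tree.  HC_CM is NOT proved; «Δ2 BRIDGE CLOSED» is NOT claimed.

References: [Liu2021] Thm. 4.18 (1) and proof (FJcycle.tex l. 2239, 2247–2253), Rem. 4.2, Rem. 4.17, Lem. 2.4 (1), Def. 4.5 (2), Def. 4.12.
-/

set_option autoImplicit false

noncomputable section

open scoped TensorProduct
open CategoryTheory NumberField Function
open Literature.AlgebraicGeometry.Motives (AbelianVariety bettiCohomology)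
open Literature.AlgebraicGeometry.HodgeTheory
open Literature.AlgebraicGeometry.ShimuraVarieties.UnitaryCanonicalModel (exists_recordSystem)
open Literature.NumberTheory.Automorphic Literature.NumberTheory.Automorphic.Liu2021 Literature.NumberTheory.Automorphic.Liu2021.AppendixC
open Literature.NumberTheory.Automorphic.Liu2021.AppendixC.RestOne
open Literature.NumberTheory.Automorphic.PicardCM
open Literature.NumberTheory.Transcendental (Arapura2012_Cor_15_4_6)
open HodgeCM HodgeCM.Model HodgeCM.Model.LevelTranslate HodgeCM.Model.TowerLevel HodgeCM.Model.TowerCarrier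
open Summit.HodgeConjecture.CorCM.D2Bridge.TowerRational

namespace Summit.HodgeConjecture.CorCM.D2Bridge.Iota1

open Summit.HodgeConjecture.CorCM.D2Bridge
open HodgeCM.Literature.Theta.LiuAlbaneseModuleDatum.D2Bridge (HcmPieces)

/-! ## §1 The reduction: R3 BY VALUE at the live pin from `J₁ : ComponentAlbaneseId` at instance `ι₁` (untwisted datum) -/

section Reduction

set_option synthInstance.maxHeartbeats 400000 in
set_option maxHeartbeats 3200000 in
/-- **R3 BY VALUE AT THE LIVE PIN FROM A COMPONENT-ALBANESE RECORD AT INSTANCE `ι₁` OVER THE UNTWISTED DATUM.**  For the literal pin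
`T := liuDictionaryPin hHD hI h₁ h₃ hA V I line`, an index line `i` and a conjugate-symplectic weight-one `μ` KEYED by the END's
`hΦμ : HasCMType L μ (line i).lineType`, a μ-uniform Weil carrier `U` over an untwisted §4.2 datum `C`, the one-object rest presented along
`ι₁`, and a component-Albanese record `J₁` under `algebraMap L ℂ = ι₁` with its level law: there are `M` (Liu's rational (4.3) record at
`U.rest (restTailOne (AlgHom.id ℚ L) ι₁ …)`) and `jH : M.HB →ₗ T.H`, injective and `U(V)(𝔸_f)`-equivariant, with
`HcmPieces (toThm418Data C (U.rest …)) M T.H jH K.K H¹(P_K;ℂ) (resTotal K) (T.cmClasses K i)` inhabited at every level `K ≤ Level.capThree K₀` —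
the four J-record binders and the `pieces` binder of the END, BY VALUE (prove-8's ✔ `exists_r3_of_componentAlbanese_iota1` over
`ComponentAlbaneseId`; X3-Char from `hΦμ` via ✔ `IsConjugateSymplectic.cmType_eq`).
[cite: Liu2021, Theorem 4.18 (1) with its proof (FJcycle.tex l. 2239, 2247–2253), Remark 4.2, Lemma 2.4 (1) (l.
        1210–1228), Definition 4.5 (2) (l. 1944–1951)] -/
theorem exists_r3Id_of_componentAlbaneseId {L : HodgeCM.CMField} [IsGalois ℚ (L : Type)] {ι₁ : L →+* ℂ}
    {V : HodgeCM.HermSpace3 L ι₁} {Φ : Literature.AlgebraicGeometry.Motives.CMType L} {isotropicAt : ℕ → Prop}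
    {μ : Literature.NumberTheory.Automorphic.IdeleClassGroup L →ₜ* Circle}
    (hμ : Literature.NumberTheory.Automorphic.IdeleClassGroup.IsConjugateSymplectic L μ)
    (hw : Literature.NumberTheory.Automorphic.IdeleClassGroup.HasWeight L μ 1) (Car : Def45.Carriers L μ)
    {hHD : exists_isReal_hodgeModel} {hI : hodgePQ_independent_of_hodgeModel}
    {h₁ : BallQuotientUniformised} {h₃ : CMAbelianVarietyRealised} {hA : Arapura2012_Cor_15_4_6} {h : exists_recordSystem}
    {C : Sec42Data (Model.honestP5IdOf h ⟨L.K⟩ ι₁ ⟨V.Hm, V.isHermitian, V.signature_ι₁, V.posDef_of_ne⟩ Φ) isotropicAt}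
    {HT : C.HeckeTranslates}
    [inst : Algebra (L : Type) ℂ] (hinst : ∀ x : L, algebraMap (L : Type) ℂ x = ι₁ x)
    (I : Type) (line : I → HodgeCM.Model.SplitLineE V) (U : UniformOmega C)
    (J₁ : ComponentAlbaneseId hHD hI (ballQuotientUniformisedDatum_of h₁) h₃ hA V h Φ C HT)
    (hΓ₁ : ∀ K₁ : C5.SmallLevel C.S.K₀, ((J₁.Γof K₁).K : Subgroup ↥V.adelicFin) = (K₁.1 : Subgroup C.G))
    (Dμ : ObjOne (AlgHom.id ℚ (L : Type)) ι₁ hμ hw Car) (τ' : L →+* ℂ) (hτ' : τ' ∈ hμ.cmType.1) (i : I)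
    (hΦμ : IdeleClassGroup.HasCMType (L : Type) μ (line i).lineType) :
    ∃ (M : (toThm418Data C (U.rest (restTailOne (AlgHom.id ℚ (L : Type)) ι₁ hμ hw Car
          (HT.rhoΩOne (AlgHom.id ℚ (L : Type)) ι₁ hμ hw Car)))).Map43RationalData)
      (jH : M.HB →ₗ[ℂ] (HodgeCM.Model.liuDictionaryPin hHD hI h₁ h₃ hA V I line).H),
      Function.Injective jH ∧
      (∀ (g : ↥V.adelicFin) (x : M.HB), jH (M.ρB g x) = MonoidAlgebra.of ℂ ↥V.adelicFin g • jH x) ∧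
      ∀ K : HodgeCM.Level V, K ≤ Level.capThree (V := V) (C.S.K₀.1 : Subgroup ↥V.adelicFin) C.S.K₀.2.1 →
        Nonempty (HcmPieces.{0, 1, 0}
          (toThm418Data C (U.rest (restTailOne (AlgHom.id ℚ (L : Type)) ι₁ hμ hw Car
            (HT.rhoΩOne (AlgHom.id ℚ (L : Type)) ι₁ hμ hw Car))))
          M (HodgeCM.Model.liuDictionaryPin hHD hI h₁ h₃ hA V I line).H jH K.K
          ((picardCMUniverse hHD hI h₁ h₃).CohC ((picardCMUniverse hHD hI h₁ h₃).pms L ι₁ V K) 1)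
          (resTotal hHD hI (ballQuotientUniformisedDatum_of h₁) h₃ hA K)
          ((HodgeCM.Model.liuDictionaryPin hHD hI h₁ h₃ hA V I line).cmClasses K i)) :=
  ⟨map43RecordAtPin J₁ (AlgHom.id ℚ (L : Type)) ι₁ hμ hw Car U.Eps U.epsOf U.Chi (U.omega μ hμ) (U.rho μ hμ) Dμ τ' hτ',
    jHPin J₁ (AlgHom.id ℚ (L : Type)) ι₁ hμ hw Car U.Eps U.epsOf U.Chi (U.omega μ hμ) (U.rho μ hμ) Dμ τ' hτ',
    jHPin_injective J₁ (AlgHom.id ℚ (L : Type)) ι₁ hμ hw Car U.Eps U.epsOf U.Chi (U.omega μ hμ) (U.rho μ hμ) Dμ τ' hτ',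
    jHPin_comm J₁ (AlgHom.id ℚ (L : Type)) ι₁ hμ hw Car U.Eps U.epsOf U.Chi (U.omega μ hμ) (U.rho μ hμ) Dμ τ' hτ',
    fun K hK => nonempty_hcmPieces_atLiuDictionaryPin hμ hw Car ι₁ hinst I line U J₁ hΓ₁ Dμ τ' hτ' i K hK
      fun d hd => by
        have hs : hμ.cmType = (line i).lineType := hμ.cmType_eq hΦμ
        rw [hs] at hd
        exact hd⟩

end Reduction

/-! ## §2 The BY-VALUE head at the END′ binder shape: R3 over `ℭ₁ ∕ 𝒯₁ ∕ 𝕌₁` from the tree terms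

No notation (kernel lane): every slot term is WRITTEN OUT — ℭ₁ = `sec42DataIdOf h isoOf ⟨F.K⟩ ι₁ ⟨V.Hm, …⟩ Φ`, 𝒯₁ =
`heckeTranslatesFamilyIdOf heckeTranslate_definedOver_holds h isoOf … h6`, 𝔠 = `Def45.Carriers.ofPolDR μ (Def45.PolDR ι₁ hμ (Def45.RMuForm ι₁ hμ))`,
𝔱₁ = `restTailOne (AlgHom.id ℚ F) ι₁ hμ hw 𝔠 (𝒯₁.rhoΩOne (AlgHom.id ℚ F) ι₁ hμ hw 𝔠)`, 𝕌₁ i = `uniformOmegaRepId h ⟨F.K⟩ ι₁ ⟨V…⟩ Φ e₁ (frameD V)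
(frameD_real V) (frameD_ne V) (ιVE V) (2 * imagUnit F)⁻¹ (fun _ _ => 𝕣 i)` (𝕣 i = the `Rep.update …` archimedean line of `ClosedPrinted.lean`),
𝔇 = the live `liuDictionaryPin` over the `_holds` rows, 𝕀 ∕ 𝕃 = `I ∕ line V (repAt a₀) (muLiu ι₁ GramClass.rep)` — i.e. the (c)(d) slot types
of `PortJoin/ClosedPrintedByValue.lean` with exactly the three tokens `sec42DataOf ↦ sec42DataIdOf`, `heckeTranslatesFamilyOf ↦
heckeTranslatesFamilyIdOf`, `uniformOmegaRep ↦ uniformOmegaRepId` flipped. -/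

section ByValue

open NumberField.InfinitePlace HodgeCM.Model.LiuIndex
open Literature.AlgebraicGeometry.ShimuraVarieties.UnitaryCanonicalModel
open Summit.HodgeConjecture.CorCM.Model
open Literature.AlgebraicGeometry.Motives (CMType)
open Literature.NumberTheory.ComplexMultiplication
open Literature.NumberTheory.Automorphic.Liu2021.Def411WeilCarriers (lineOf locF Rep)
open Summit.HodgeConjecture.CorCM.Transposition.OmegaTransport (realUnit)
open HodgeCM.Model.ArchSideTerm (e₁)
open Literature.NumberTheory.GelbartRogawski1991 Literature.NumberTheory.GelbartRogawski1991.UnitaryDualPair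
open Literature.RepresentationTheory Literature.RepresentationTheory.Liu2021
open Summit.HodgeConjecture.CorCM.Transposition

set_option synthInstance.maxHeartbeats 400000 in
set_option maxHeartbeats 6400000 in
/-- **R3 BY VALUE AT THE LIVE PIN, END′ BINDER SHAPE** — for every index line `i`, every conjugate-symplectic weight-one `μ` keyed
`Φ_μ = (line i).lineType`: the (4.3) record `M`, its reading `jH` into `(𝔇).H` (injective, `ℂ[U(V)(𝔸_F^∞)]`-equivariant) and the pieces
`HcmPieces … ((𝔇).cmClasses K i)` below `Level.capThree ℭ₁.S.K₀`, at the rest `(𝕌₁ i).rest 𝔱₁` over the UNTWISTED datum — from the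
tree terms only: `J₁ := componentAlbanesePinTotalId …` (I5) at `ι₁.toAlgebra`, `Dμ := socketDμ F ι₁ h21 μ hμ hw` ([Shimura1998] Thm. 21.4),
`τ' :=` a member of `Φ_μ`.  One displayed input beyond the END's record rows: `h21` (already displayed by §B).  HC_CM is NOT proved.
[cite: Liu2021, Thm. 4.18 (1) (FJcycle.tex l. 2239) and proof (l. 2247–2253), Rem. 4.2, Rem. 4.17, Lem. 2.4 (1), Def.
        4.5 (2) (l. 1944–1951)] [cite: Shimura1998, §21.4 Thm. 21.4] -/
theorem exists_r3Id (F : HodgeCM.CMField) [IsGalois ℚ (F : Type)] (h6 : 6 ≤ Module.finrank ℚ (F : Type))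
    {ι₁ : (F : Type) →+* ℂ} (V : HodgeCM.HermSpace3 F ι₁) (a₀ : RealScalar F) (h : exists_recordSystem) (Φ : CMType (F : Type))
    (h21 : shimura1998_thm21_4_casselman) (i : (I V (repAt a₀) (muLiu ι₁ GramClass.rep)))
    (μ : Literature.NumberTheory.Automorphic.IdeleClassGroup (F : Type) →ₜ* Circle)
    (hμ : IdeleClassGroup.IsConjugateSymplectic (F : Type) μ) (hw : IdeleClassGroup.HasWeight (F : Type) μ 1)
    (hΦμ : IdeleClassGroup.HasCMType (F : Type) μ ((line V (repAt a₀) (muLiu ι₁ GramClass.rep)) i).lineType) :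
    ∃ (M : (toThm418Data _ (((uniformOmegaRepId h ⟨HodgeCM.CMField.K F⟩ ι₁ ⟨HodgeCM.HermSpace3.Hm V,
        HodgeCM.HermSpace3.isHermitian V, HodgeCM.HermSpace3.signature_ι₁ V, HodgeCM.HermSpace3.posDef_of_ne V⟩ Φ e₁
        (frameD V) (frameD_real V) (frameD_ne V) (ιVE V) (2 * imagUnit (HodgeCM.CMField.K F))⁻¹ (fun _ _ =>
        (Rep.update ↥(maximalRealSubfield (HodgeCM.CMField.K F)) (imagUnitSq (HodgeCM.CMField.K F)) (Rep.ofLineOf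
        ↥(maximalRealSubfield (HodgeCM.CMField.K F)) (imagUnitSq (HodgeCM.CMField.K F))) (locF ↥(maximalRealSubfield
        (HodgeCM.CMField.K F)) (imagUnitSq (HodgeCM.CMField.K F)) (realUnit ⟨HodgeCM.CMField.K F⟩ (repAt a₀ (Sigma.fst
        i)).1 (repAt a₀ (Sigma.fst i)).2.1 (repAt a₀ (Sigma.fst i)).2.2)) (realUnit ⟨HodgeCM.CMField.K F⟩ (repAt a₀
        (Sigma.fst i)).1 (repAt a₀ (Sigma.fst i)).2.1 (repAt a₀ (Sigma.fst i)).2.2) rfl)))).rest (restTailOne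
        (AlgHom.id ℚ _) ι₁ hμ hw (Def45.Carriers.ofPolDR μ (Def45.PolDR ι₁ hμ (Def45.RMuForm ι₁ hμ)))
        ((heckeTranslatesFamilyIdOf heckeTranslate_definedOver_holds h isoOf ⟨HodgeCM.CMField.K F⟩ ι₁
        ⟨HodgeCM.HermSpace3.Hm V, HodgeCM.HermSpace3.isHermitian V, HodgeCM.HermSpace3.signature_ι₁ V,
        HodgeCM.HermSpace3.posDef_of_ne V⟩ Φ h6).rhoΩOne (AlgHom.id ℚ _) ι₁ hμ hw (Def45.Carriers.ofPolDR μ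
        (Def45.PolDR ι₁ hμ (Def45.RMuForm ι₁ hμ))))))).Map43RationalData)
      (jH : M.HB →ₗ[ℂ] ((liuDictionaryPin exists_isReal_hodgeModel_holds hodgePQ_independent_of_hodgeModel_holds
          BallQuotient.ballQuotientUniformised_holds (cmAbelianVarietyRealised_of_eigenbasis
          exists_isReal_hodgeModel_holds hodgePQ_independent_of_hodgeModel_holds
          cmAbelianVarietyEigenbasisRealised_holds)
          Literature.NumberTheory.Transcendental.arapura2012_cor_15_4_6_holds V (I V (repAt a₀) (muLiu ι₁
          GramClass.rep)) (line V (repAt a₀) (muLiu ι₁ GramClass.rep)))).H),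
      Function.Injective jH ∧
      (∀ (g : ↥V.adelicFin) (x : M.HB), jH (M.ρB g x) = MonoidAlgebra.of ℂ ↥V.adelicFin g • jH x) ∧
      ∀ K : HodgeCM.Level V,
        K ≤ HodgeCM.Level.capThree (V := V) (((sec42DataIdOf h isoOf ⟨HodgeCM.CMField.K F⟩ ι₁ ⟨HodgeCM.HermSpace3.Hm
            V, HodgeCM.HermSpace3.isHermitian V, HodgeCM.HermSpace3.signature_ι₁ V, HodgeCM.HermSpace3.posDef_of_ne V⟩
            Φ)).S.K₀.1 : Subgroup ↥V.adelicFin) ((sec42DataIdOf h isoOf ⟨HodgeCM.CMField.K F⟩ ι₁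
            ⟨HodgeCM.HermSpace3.Hm V, HodgeCM.HermSpace3.isHermitian V, HodgeCM.HermSpace3.signature_ι₁ V,
            HodgeCM.HermSpace3.posDef_of_ne V⟩ Φ)).S.K₀.2.1 →
        Nonempty (HcmPieces.{0, 1, 0} (toThm418Data _ (((uniformOmegaRepId h ⟨HodgeCM.CMField.K F⟩ ι₁
            ⟨HodgeCM.HermSpace3.Hm V, HodgeCM.HermSpace3.isHermitian V, HodgeCM.HermSpace3.signature_ι₁ V,
            HodgeCM.HermSpace3.posDef_of_ne V⟩ Φ e₁ (frameD V) (frameD_real V) (frameD_ne V) (ιVE V) (2 * imagUnit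
            (HodgeCM.CMField.K F))⁻¹ (fun _ _ => (Rep.update ↥(maximalRealSubfield (HodgeCM.CMField.K F)) (imagUnitSq
            (HodgeCM.CMField.K F)) (Rep.ofLineOf ↥(maximalRealSubfield (HodgeCM.CMField.K F)) (imagUnitSq
            (HodgeCM.CMField.K F))) (locF ↥(maximalRealSubfield (HodgeCM.CMField.K F)) (imagUnitSq (HodgeCM.CMField.K
            F)) (realUnit ⟨HodgeCM.CMField.K F⟩ (repAt a₀ (Sigma.fst i)).1 (repAt a₀ (Sigma.fst i)).2.1 (repAt a₀
            (Sigma.fst i)).2.2)) (realUnit ⟨HodgeCM.CMField.K F⟩ (repAt a₀ (Sigma.fst i)).1 (repAt a₀ (Sigma.fst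
            i)).2.1 (repAt a₀ (Sigma.fst i)).2.2) rfl)))).rest (restTailOne (AlgHom.id ℚ _) ι₁ hμ hw
            (Def45.Carriers.ofPolDR μ (Def45.PolDR ι₁ hμ (Def45.RMuForm ι₁ hμ))) ((heckeTranslatesFamilyIdOf
            heckeTranslate_definedOver_holds h isoOf ⟨HodgeCM.CMField.K F⟩ ι₁ ⟨HodgeCM.HermSpace3.Hm V,
            HodgeCM.HermSpace3.isHermitian V, HodgeCM.HermSpace3.signature_ι₁ V, HodgeCM.HermSpace3.posDef_of_ne V⟩ Φ
            h6).rhoΩOne (AlgHom.id ℚ _) ι₁ hμ hw (Def45.Carriers.ofPolDR μ (Def45.PolDR ι₁ hμ (Def45.RMuForm ι₁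
            hμ)))))))
          M ((liuDictionaryPin exists_isReal_hodgeModel_holds hodgePQ_independent_of_hodgeModel_holds
              BallQuotient.ballQuotientUniformised_holds (cmAbelianVarietyRealised_of_eigenbasis
              exists_isReal_hodgeModel_holds hodgePQ_independent_of_hodgeModel_holds
              cmAbelianVarietyEigenbasisRealised_holds)
              Literature.NumberTheory.Transcendental.arapura2012_cor_15_4_6_holds V (I V (repAt a₀) (muLiu ι₁
              GramClass.rep)) (line V (repAt a₀) (muLiu ι₁ GramClass.rep)))).H jH K.K
          ((HodgeCM.Model.picardCMUniverse exists_isReal_hodgeModel_holds hodgePQ_independent_of_hodgeModel_holds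
              BallQuotient.ballQuotientUniformised_holds
              (cmAbelianVarietyRealised_of_eigenbasis exists_isReal_hodgeModel_holds hodgePQ_independent_of_hodgeModel_holds
                cmAbelianVarietyEigenbasisRealised_holds)).CohC
            ((HodgeCM.Model.picardCMUniverse exists_isReal_hodgeModel_holds hodgePQ_independent_of_hodgeModel_holds
              BallQuotient.ballQuotientUniformised_holds
              (cmAbelianVarietyRealised_of_eigenbasis exists_isReal_hodgeModel_holds hodgePQ_independent_of_hodgeModel_holds
                cmAbelianVarietyEigenbasisRealised_holds)).pms F ι₁ V K) 1)
          (resTotal exists_isReal_hodgeModel_holds hodgePQ_independent_of_hodgeModel_holds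
            (ballQuotientUniformisedDatum_of BallQuotient.ballQuotientUniformised_holds)
            (cmAbelianVarietyRealised_of_eigenbasis exists_isReal_hodgeModel_holds hodgePQ_independent_of_hodgeModel_holds
              cmAbelianVarietyEigenbasisRealised_holds)
            Literature.NumberTheory.Transcendental.arapura2012_cor_15_4_6_holds K)
          (((liuDictionaryPin exists_isReal_hodgeModel_holds hodgePQ_independent_of_hodgeModel_holds
              BallQuotient.ballQuotientUniformised_holds (cmAbelianVarietyRealised_of_eigenbasis
              exists_isReal_hodgeModel_holds hodgePQ_independent_of_hodgeModel_holds
              cmAbelianVarietyEigenbasisRealised_holds)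
              Literature.NumberTheory.Transcendental.arapura2012_cor_15_4_6_holds V (I V (repAt a₀) (muLiu ι₁
              GramClass.rep)) (line V (repAt a₀) (muLiu ι₁ GramClass.rep)))).cmClasses K i)) := by
  letI : Algebra (F : Type) ℂ := ι₁.toAlgebra
  exact exists_r3Id_of_componentAlbaneseId hμ hw ((Def45.Carriers.ofPolDR μ (Def45.PolDR ι₁ hμ (Def45.RMuForm ι₁
        hμ)))) (fun _ => rfl) ((I V (repAt a₀) (muLiu ι₁ GramClass.rep))) ((line V (repAt a₀) (muLiu ι₁
        GramClass.rep)))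
    ((uniformOmegaRepId h ⟨HodgeCM.CMField.K F⟩ ι₁ ⟨HodgeCM.HermSpace3.Hm V, HodgeCM.HermSpace3.isHermitian V,
        HodgeCM.HermSpace3.signature_ι₁ V, HodgeCM.HermSpace3.posDef_of_ne V⟩ Φ e₁ (frameD V) (frameD_real V)
        (frameD_ne V) (ιVE V) (2 * imagUnit (HodgeCM.CMField.K F))⁻¹ (fun _ _ => (Rep.update ↥(maximalRealSubfield
        (HodgeCM.CMField.K F)) (imagUnitSq (HodgeCM.CMField.K F)) (Rep.ofLineOf ↥(maximalRealSubfield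
        (HodgeCM.CMField.K F)) (imagUnitSq (HodgeCM.CMField.K F))) (locF ↥(maximalRealSubfield (HodgeCM.CMField.K F))
        (imagUnitSq (HodgeCM.CMField.K F)) (realUnit ⟨HodgeCM.CMField.K F⟩ (repAt a₀ (Sigma.fst i)).1 (repAt a₀
        (Sigma.fst i)).2.1 (repAt a₀ (Sigma.fst i)).2.2)) (realUnit ⟨HodgeCM.CMField.K F⟩ (repAt a₀ (Sigma.fst i)).1
        (repAt a₀ (Sigma.fst i)).2.1 (repAt a₀ (Sigma.fst i)).2.2) rfl))))
    (componentAlbanesePinTotalId exists_isReal_hodgeModel_holds hodgePQ_independent_of_hodgeModel_holds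
      (ballQuotientUniformisedDatum_of BallQuotient.ballQuotientUniformised_holds)
      (cmAbelianVarietyRealised_of_eigenbasis exists_isReal_hodgeModel_holds hodgePQ_independent_of_hodgeModel_holds
        cmAbelianVarietyEigenbasisRealised_holds)
      Literature.NumberTheory.Transcendental.arapura2012_cor_15_4_6_holds heckeTranslate_definedOver_holds V h
      (le_trans (by norm_num) h6) Φ isoOf)
    (componentAlbanesePinTotalId_levelLaw exists_isReal_hodgeModel_holds hodgePQ_independent_of_hodgeModel_holds
      (ballQuotientUniformisedDatum_of BallQuotient.ballQuotientUniformised_holds)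
      (cmAbelianVarietyRealised_of_eigenbasis exists_isReal_hodgeModel_holds hodgePQ_independent_of_hodgeModel_holds
        cmAbelianVarietyEigenbasisRealised_holds)
      Literature.NumberTheory.Transcendental.arapura2012_cor_15_4_6_holds heckeTranslate_definedOver_holds V h
      (le_trans (by norm_num) h6) Φ isoOf)
    (socketDμ F ι₁ h21 μ hμ hw) (exists_mem_of_cmType hμ.cmType ι₁).choose (exists_mem_of_cmType hμ.cmType ι₁).choose_spec i hΦμ

end ByValue

end Summit.HodgeConjecture.CorCM.D2Bridge.Iota1

end
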